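import Summits.QuantumFields.YangMills.Theorems.UnitScaleTiltProp7TransverseRowOfTubeRowRegPr
import HarnessLib

/-!
# Route `UnitScaleTilt`, crux «MinimiserStabilityRegPr» (stmt-QuantumFields-19200, stub EX), node N06(d = 3), route (α) — **TWO RIDERS ON w7's (T)-KNIT
# ✓`Prop7TransverseRowOfTubeRowRegPr`: (i) THE FULL-LANDAU FLOOR `c_T‖X̃‖² ≤ re⟨X̃, Δ^ηX̃⟩ + ‖D*X̃‖² + a_T‖Q_kX̃‖²` FOR EVERY CARRIER (not only `D*Y = 0`), MODULO THE SAME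
# TUBE-COMPARISON ROW `hQcmp`; (ii) THE (T) ROW AT ANY LARGER COUPLING `a ≥ a_T`** (the penalty is monotone in `a`)

Cell `ym3-torus` (HUMAN RULING D-0037, YM ladder rung R3 — YM₃ on T³ is a RUNG, NOT d = 4, NOT the Clay problem; the YM mass gap is NOT proved).  Fleet lead seat
`ym-ust-19200-p1` (gen 23), chair of the positivity knit; file 4 as re-cut after the de-twin with w7 g10 (bus 20:19:39Z: the (T)-knit proper = w7 FILE 3 ✓p743306; these two
rows «are not twins and are welcome … as a 2-theorem door importing my file»).  THEOREMS ONLY (0 `def`, 0 `sorry`); `--supports stmt-QuantumFields-19200 --as helper`; count-neutral.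

THE PRINT.  [Balaban1985BackgroundPropagators] Thm 3.11 p. 416; (3.10)–(3.12) p. 392; (3.26) p. 395 (`Δ_a = Δ + DRD* + Q*aQ`); (3.118)–(3.122) pp. 419–420.

WHAT IS PROVED (ns `…Theorems.Prop7FullLandauFloorOfTubeRow`; member `F n K`, `h : n ≤ K`, weights `c₀ cB > 0`, `U₀ ∈ RegPr ε₀`, `216ε₀ ≤ 1`, `16Cq·ε₀² ≤ 1`; the row `hQcmp`
of ✓`Prop7TransverseRowOfQTwSTubeComparison` DISPLAYED, asserted for nothing).
* ★★★ `floor_full_of_tubeRow` — for EVERY carrier `X` (`X̃ = toL2 X`, `ℓ = L^{K−n}`):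
  `((1 − 16Cq·ε₀²)∕36 − 1029ε₀)·‖X̃‖² ≤ re⟨X̃, Δ^η(U₀)X̃⟩ + ‖D*_{U₀}X̃‖² + (16∕9)(c₀∕cB)ℓ³·‖Q_k(U₀)X̃‖²` — the coercivity of `Δ^η + DD* + aQ_k†Q_k` (print's `Δ_a` (3.26) with the
  FULL Landau term `DD*` in place of `DR_SD*`), member-uniform constants; same knit as w7's `transverseRow_of_tubeRow` with the engine's divergence term KEPT
  (✓`Prop7DivSliceOfMemberDivSq.norm_sq_DstarL2_toL2_eq`: it IS `‖D*X̃‖²∕(c₀ℓ²)`), w7's §1 dictionary BY NAME (`curlSum_eq_posPlaq`, `regThreshold_eq`, `sum_normSq_QTwS_le_norm_Qk`).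
* ★★ `hT_of_tubeRow_of_le` — w7's ★★`hT_of_tubeRow` at any coupling `a ≥ (16∕9)(c₀∕cB)ℓ^d` (one `mul_le_mul`): the shape the family doors ✓`hGF_of_TGX_rows` ∕ ✓`hGF_lift_of_TGX_rows`
  consume at the face's `a L i`.
EFFECT: with ✓p743306, the door ✓p741159's (T) row is kernel modulo `hQcmp` at every `a ≥ a_T`; the full-Landau floor is the `DD*` cousin of ★w4's `norm_G₀` currency (the
difference `DD* − DR_SD*` is exactly the slice-gauge sector of LOCATE-GAMMA-ROW §1 (G)).  HONEST SCOPE: arithmetic over landed rows; `hQcmp` displayed; γ-row, print rows, EX, crux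
NOT proved; nothing continuum ∕ OS ∕ mass-gap ∕ Clay.

References: T. Bałaban, CMP **99** (1985) 389–434 [Balaban1985BackgroundPropagators] (Thm 3.11 p.416, (3.10)–(3.12) p.392, (3.26) p.395, (3.118)–(3.122) pp.419–420);
CMP **102** (1985) 277–309 [Balaban1985Variational] ((14) p.280, (141)–(142) p.299).
-/

set_option autoImplicit false

noncomputable section

open scoped InnerProductSpace ComplexConjugate Matrix.Norms.L2Operator BigOperators Matrix

namespace Summit.QuantumFields.YangMills.Theorems.Prop7FullLandauFloorOfTubeRow

open Literature.MathematicalPhysics.QuantumFieldTheory.Balaban1983to89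
open Literature.MathematicalPhysics.QuantumFieldTheory.Balaban1983to89.T3ContinuumYM3Torus
open Literature.MathematicalPhysics.QuantumFieldTheory.Balaban1983to89.T3PrintedRegularMinimiser (RegPr)
open Finset B1RG242Torus
open B7Prop1Explicit (treeWord)
open B7Eq78Linearization (conjR)
open B9Eq39Adjoint (curl divB posPlaq)
open B10Eq27TorusAxialLog (holT unitsField toUField)
open B9TorusCalculus (torusT)
open T3SectALandauChart (formComp bgUnits eta eta_pos)
open T3RegularMinimiser (regThreshold)
open B9Eq311L2Pairing (WL2)
open B11Eq103H1Complex (SiteL2K BondL2K)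
open Summit.QuantumFields.YangMills.Theorems.Prop7SectET3Transport (periodsT3)
open Summit.QuantumFields.YangMills.Theorems.Prop7SectET3HilbertLetters (W₂ frobEquiv toL2 toL2B QL2 DL2 DstarL2)
open Summit.QuantumFields.YangMills.Theorems.Prop7SectET3WilsonHessian (DeltaEta)
open Summit.QuantumFields.YangMills.Theorems.Prop7SectET3CurvedPropagators (Qk)
open Summit.QuantumFields.YangMills.Theorems.Prop7SymAvgTwSym (QTwS)
open Summit.QuantumFields.YangMills.Theorems.Prop7TransverseRowOfQTwSTubeComparison (sum_normSq_le_curl_sq_add_divB_sq_add_QTwS_of_tubeRow)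
open Summit.QuantumFields.YangMills.Theorems.Prop7PureGaugeCurlCurvature (principal_two_sided_of_regPr)
open Summit.QuantumFields.YangMills.Theorems.Prop7DivSliceOfMemberDivSq (norm_sq_DstarL2_toL2_eq inv_eta_sq_eq)
open Summit.QuantumFields.YangMills.Theorems.Prop7TransverseRowOfTubeRowRegPr (curlSum_eq_posPlaq regThreshold_eq sum_normSq_QTwS_le_norm_Qk hT_of_tubeRow)

variable (F : T3Family) (n K : ℕ) (h : n ≤ K) (c₀ cB : ℝ) [Fact (0 < c₀)] [Fact (0 < cB)]

/-! ## §1 The full-space floor with the Landau penalty `‖D*X̃‖²`, modulo the tube-comparison row -/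

/-- ★★★ **THE FULL-SPACE FLOOR MODULO `hQcmp`**: on `RegPr ε₀` (`0 ≤ ε₀`, `216ε₀ ≤ 1`, `16Cq·ε₀² ≤ 1`), for EVERY carrier `X` satisfying w7's displayed tube-comparison row
`hQcmp` (pen (b1)), with `X̃ = toL2 X`, `ℓ = L^{K−n}`:
`((1 − 16Cq·ε₀²)∕36 − 1029ε₀)·‖X̃‖² ≤ re⟨X̃, Δ^η(U₀)X̃⟩ + ‖D*_{U₀}X̃‖² + (16∕9)(c₀∕cB)ℓ³·‖Q_k(U₀)X̃‖²`.
Proof: w7's knit with the divergence term kept. [cite: Balaban1985BackgroundPropagators, Thm 3.11 p.416, (3.10) p.392; Balaban1985Variational, (141)–(142) p.299] -/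
theorem floor_full_of_tubeRow {ε₀ : ℝ} (hε₀ : 0 ≤ ε₀) (hε1 : 216 * ε₀ ≤ 1)
    (U₀ : GaugeField (F.P K) 0 (Matrix.specialUnitaryGroup (Fin 2) ℂ)) (hreg : RegPr F n K ε₀ U₀)
    (X : PBond (F.P K) 0 → Matrix (Fin 2) (Fin 2) ℂ) {Cq : ℝ} (hCq : 16 * Cq * ε₀ ^ 2 ≤ 1)
    (hQcmp : ∑ c : PBond (F.P K) (K - n), ‖∑ r : Fin (F.P K).d → Fin ((F.P K).L ^ (K - n)), ∑ t ∈ range ((F.P K).L ^ (K - n)),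
        conjR (holT (unitsField (toUField U₀)) (Site.fibreSite 0 (K - n) c.src fun _ => ⟨0, pow_pos (F.P K).L_pos (K - n)⟩)
              (treeWord fun ν => ((r ν : ℕ) : ℤ))
            * holT (unitsField (toUField U₀)) (Site.fibreSite 0 (K - n) c.src r) (List.replicate t (c.dir, true)))
          (X ⟨(fun z : Site (F.P K) 0 => z.shift c.dir)^[t] (Site.fibreSite 0 (K - n) c.src r), c.dir⟩)‖ ^ 2
      ≤ 2 * (((F.L : ℝ) ^ (K - n)) ^ (F.P K).d) ^ 2 * ∑ c' : PBond (F.P n) 0, ‖QTwS F n K h U₀ X c'‖ ^ 2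
        + Cq * ε₀ ^ 2 * (((F.L : ℝ) ^ (K - n)) ^ (F.P K).d * ((F.L : ℝ) ^ (K - n)) ^ 2) * ∑ b : PBond (F.P K) 0, ‖X b‖ ^ 2) :
    ((1 - 16 * Cq * ε₀ ^ 2) / 36 - 1029 * ε₀) * ‖toL2 F K c₀ X‖ ^ 2
      ≤ RCLike.re ⟪toL2 F K c₀ X, DeltaEta F n K c₀ U₀ (toL2 F K c₀ X)⟫_ℂ + ‖DstarL2 F n K c₀ U₀ (toL2 F K c₀ X)‖ ^ 2
        + (16 / 9 * (c₀ / cB) * ((F.L : ℝ) ^ (K - n)) ^ 3) * ‖Qk F n K h c₀ cB U₀ (toL2 F K c₀ X)‖ ^ 2 := by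
  have hc₀ : 0 < c₀ := Fact.out
  have hcB : 0 < cB := Fact.out
  have hLpos : (0 : ℝ) < (F.L : ℝ) ^ (K - n) := by
    have : (0 : ℝ) < F.L := by have := F.hL.2; exact_mod_cast (by omega : 0 < F.L)
    positivity
  -- letters
  set l : ℝ := (F.L : ℝ) ^ (K - n) with hl
  set S : ℝ := ∑ b : PBond (F.P K) 0, ‖X b‖ ^ 2 with hS
  set CU : ℝ := ∑ x : Site (F.P K) 0, ∑ μ : Fin (F.P K).d, ∑ ν : Fin (F.P K).d,
      (if μ < ν then ∑ j : Fin 2, ∑ k : Fin 2,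
        ‖(curl (torusT (F.P K) 0) (fun κ z => unitsField (toUField U₀) ⟨z, κ⟩) (fun κ z => X ⟨z, κ⟩) μ ν x) j k‖ ^ 2 else 0) with hCU
  set DV : ℝ := ∑ x : Site (F.P K) 0, ∑ j : Fin 2, ∑ k : Fin 2,
      ‖(divB (torusT (F.P K) 0) (fun κ z => unitsField (toUField U₀) ⟨z, κ⟩) (fun κ z => X ⟨z, κ⟩) x) j k‖ ^ 2 with hDV
  set QT : ℝ := ∑ c' : PBond (F.P n) 0, ‖QTwS F n K h U₀ X c'‖ ^ 2 with hQT
  set N : ℝ := ‖toL2 F K c₀ X‖ ^ 2 with hN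
  set E : ℝ := RCLike.re ⟪toL2 F K c₀ X, DeltaEta F n K c₀ U₀ (toL2 F K c₀ X)⟫_ℂ with hE
  set D : ℝ := ‖DstarL2 F n K c₀ U₀ (toL2 F K c₀ X)‖ ^ 2 with hD
  set Q : ℝ := ‖Qk F n K h c₀ cB U₀ (toL2 F K c₀ X)‖ ^ 2 with hQ
  -- (E) the engine modulo `hQcmp`
  -- the plaquette clause of `RegPr` in the engine's shape (w7's ✓`regThreshold_eq`)
  have hU : ∀ p : Plaq (F.P K) 0, dist1 (GaugeField.plaqHol U₀ p) ≤ ε₀ * (((F.L : ℝ) ^ (K - n)) ^ 2)⁻¹ := fun p => by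
    have hp := hreg.plaqSmall p
    rw [regThreshold_eq] at hp
    exact hp.le
  have hEng := sum_normSq_le_curl_sq_add_divB_sq_add_QTwS_of_tubeRow F n K h U₀ hε₀ hε1 hU X Cq hQcmp
  -- (P) the principal two-sided bound, lower half, read on the engine's curl sum
  have hP : c₀ * l ^ 2 * CU - 1029 * ε₀ * N ≤ E := by
    have h1 := (principal_two_sided_of_regPr (c₀ := c₀) hε₀ U₀ hreg X).1
    rw [← curlSum_eq_posPlaq F K U₀ X, inv_eta_sq_eq F n K] at h1
    exact h1
  -- (D) the divergence seam
  have hDV : D = c₀ * l ^ 2 * DV := norm_sq_DstarL2_toL2_eq F n K c₀ U₀ X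
  -- (N) the fine norm vs the operator-norm sum
  have hNS : N ≤ 2 * c₀ * S := Prop7SigmaRowsNorm.norm_sq_toL2_le_two_mul F K c₀ X
  -- (Q) the averaging sum vs `‖Q_kX̃‖²`
  have hQT' : QT ≤ l ^ 2 / cB * Q := by
    have hw := sum_normSq_QTwS_le_norm_Qk F n K h c₀ cB U₀ X
    -- `cB·ℓ⁻²·QT ≤ Q`
    have hl2' : 0 < l ^ 2 := by positivity
    rw [div_mul_eq_mul_div, le_div_iff₀ hcB]
    calc QT * cB = l ^ 2 * (cB * (l ^ 2)⁻¹ * QT) := by field_simp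
      _ ≤ l ^ 2 * Q := mul_le_mul_of_nonneg_left hw hl2'.le
  -- d = 3: the engine's `Q` coefficient is `32∕ℓ`
  have hd : (F.P K).d = 3 := T3Family.P_d F K
  have hcoef : 32 * ((((l ^ (F.P K).d) * l ^ 2)⁻¹ * (l ^ 2)⁻¹)) * (l ^ (F.P K).d) ^ 2 = 32 / l := by
    rw [hd, div_eq_mul_inv]
    field_simp
  rw [hcoef] at hEng
  -- nonnegativities
  have hCU0 : 0 ≤ CU := by
    refine Finset.sum_nonneg fun x _ => Finset.sum_nonneg fun μ _ => Finset.sum_nonneg fun ν _ => ?_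
    split_ifs
    · exact Finset.sum_nonneg fun j _ => Finset.sum_nonneg fun k _ => sq_nonneg _
    · exact le_rfl
  have hQ0 : 0 ≤ Q := sq_nonneg _
  have hQT0 : 0 ≤ QT := Finset.sum_nonneg fun c _ => sq_nonneg _
  have hS0 : 0 ≤ S := Finset.sum_nonneg fun b _ => sq_nonneg _
  have hfac : 0 ≤ 1 - 16 * Cq * ε₀ ^ 2 := by linarith
  -- assemble: multiply the engine by `c₀ℓ²∕18`
  have hl2 : 0 < l ^ 2 := by positivity
  have hEng' : (1 - 16 * Cq * ε₀ ^ 2) * ((l ^ 2)⁻¹ * S) ≤ 18 * (CU + DV) + 32 / l * QT := hEng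
  have h1 : (1 - 16 * Cq * ε₀ ^ 2) * S ≤ l ^ 2 * (18 * (CU + DV) + 32 / l * QT) :=
    calc (1 - 16 * Cq * ε₀ ^ 2) * S = l ^ 2 * ((1 - 16 * Cq * ε₀ ^ 2) * ((l ^ 2)⁻¹ * S)) := by field_simp
      _ ≤ l ^ 2 * (18 * (CU + DV) + 32 / l * QT) := mul_le_mul_of_nonneg_left hEng' hl2.le
  have hA : (1 - 16 * Cq * ε₀ ^ 2) * N ≤ (1 - 16 * Cq * ε₀ ^ 2) * (2 * c₀ * S) := mul_le_mul_of_nonneg_left hNS hfac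
  have hB : 32 / l * QT ≤ 32 / l * (l ^ 2 / cB * Q) := mul_le_mul_of_nonneg_left hQT' (by positivity)
  have step1 : (1 - 16 * Cq * ε₀ ^ 2) * N ≤ 2 * c₀ * (l ^ 2 * (18 * (CU + DV) + 32 / l * QT)) :=
    calc (1 - 16 * Cq * ε₀ ^ 2) * N ≤ (1 - 16 * Cq * ε₀ ^ 2) * (2 * c₀ * S) := hA
      _ = 2 * c₀ * ((1 - 16 * Cq * ε₀ ^ 2) * S) := by ring
      _ ≤ 2 * c₀ * (l ^ 2 * (18 * (CU + DV) + 32 / l * QT)) := mul_le_mul_of_nonneg_left h1 (by positivity)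
  have step3 : l ^ 2 * (18 * (CU + DV) + 32 / l * QT) ≤ l ^ 2 * (18 * (CU + DV) + 32 / l * (l ^ 2 / cB * Q)) :=
    mul_le_mul_of_nonneg_left (by linarith [hB]) hl2.le
  have step4 : (1 - 16 * Cq * ε₀ ^ 2) * N ≤ 2 * c₀ * (l ^ 2 * (18 * (CU + DV) + 32 / l * (l ^ 2 / cB * Q))) :=
    step1.trans (mul_le_mul_of_nonneg_left step3 (by positivity))
  have e1 : 2 * c₀ * (l ^ 2 * (18 * (CU + DV) + 32 / l * (l ^ 2 / cB * Q)))
      = 36 * (c₀ * l ^ 2 * CU) + 36 * (c₀ * l ^ 2 * DV) + 36 * (16 / 9 * (c₀ / cB) * l ^ 3 * Q) := by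
    field_simp
    ring
  rw [e1, ← hDV] at step4
  -- conclude: `step4 ∕ 36 + hP`
  have hkey : ((1 - 16 * Cq * ε₀ ^ 2) / 36 - 1029 * ε₀) * N ≤ E + D + 16 / 9 * (c₀ / cB) * l ^ 3 * Q := by
    linarith [step4, hP]
  exact hkey

/-! ## §2 The (T) row at any larger coupling -/

/-- ★★ **w7's (T) ROW AT ANY LARGER COUPLING** (`a ≥ (16∕9)(c₀∕cB)ℓ^d`; `‖Q_kY‖² ≥ 0`): the `hT` binder of the Schur doors at the face's own `a`.
[cite: Balaban1985BackgroundPropagators, Thm 3.11 p.416, (3.118)–(3.122) pp.419–420] -/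
theorem hT_of_tubeRow_of_le {ε₀ : ℝ} (hε₀ : 0 ≤ ε₀) (hε1 : 216 * ε₀ ≤ 1)
    (U₀ : GaugeField (F.P K) 0 (Matrix.specialUnitaryGroup (Fin 2) ℂ)) (hreg : RegPr F n K ε₀ U₀) {Cq : ℝ} (hwin : 16 * Cq * ε₀ ^ 2 ≤ 1)
    {a : ℝ} (ha : 16 / 9 * (c₀ / cB) * ((F.L : ℝ) ^ (K - n)) ^ (F.P K).d ≤ a)
    (hQcmp : ∀ X : PBond (F.P K) 0 → Matrix (Fin 2) (Fin 2) ℂ,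
      ∑ c : PBond (F.P K) (K - n), ‖∑ r : Fin (F.P K).d → Fin ((F.P K).L ^ (K - n)), ∑ t ∈ range ((F.P K).L ^ (K - n)),
        conjR (holT (unitsField (toUField U₀)) (Site.fibreSite 0 (K - n) c.src fun _ => ⟨0, pow_pos (F.P K).L_pos (K - n)⟩)
              (treeWord fun ν => ((r ν : ℕ) : ℤ))
            * holT (unitsField (toUField U₀)) (Site.fibreSite 0 (K - n) c.src r) (List.replicate t (c.dir, true)))
          (X ⟨(fun z : Site (F.P K) 0 => z.shift c.dir)^[t] (Site.fibreSite 0 (K - n) c.src r), c.dir⟩)‖ ^ 2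
      ≤ 2 * (((F.L : ℝ) ^ (K - n)) ^ (F.P K).d) ^ 2 * ∑ c' : PBond (F.P n) 0, ‖QTwS F n K h U₀ X c'‖ ^ 2
        + Cq * ε₀ ^ 2 * (((F.L : ℝ) ^ (K - n)) ^ (F.P K).d * ((F.L : ℝ) ^ (K - n)) ^ 2) * ∑ b : PBond (F.P K) 0, ‖X b‖ ^ 2) :
    ∀ Y : BondL2K ℂ 3 (periodsT3 F K) c₀ W₂, DstarL2 F n K c₀ U₀ Y = 0 →
      (1 - 16 * Cq * ε₀ ^ 2 - 37044 * ε₀) / 36 * ‖Y‖ ^ 2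
        ≤ RCLike.re ⟪Y, DeltaEta F n K c₀ U₀ Y⟫_ℂ + a * ‖Qk F n K h c₀ cB U₀ Y‖ ^ 2 := by
  intro Y hY
  have h1 := hT_of_tubeRow F n K h c₀ cB hε₀ hε1 U₀ hreg hwin hQcmp Y hY
  have h2 : 16 / 9 * (c₀ / cB) * ((F.L : ℝ) ^ (K - n)) ^ (F.P K).d * ‖Qk F n K h c₀ cB U₀ Y‖ ^ 2 ≤ a * ‖Qk F n K h c₀ cB U₀ Y‖ ^ 2 :=
    mul_le_mul_of_nonneg_right ha (sq_nonneg _)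
  linarith

end Summit.QuantumFields.YangMills.Theorems.Prop7FullLandauFloorOfTubeRow

end
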